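import Literature.Analysis.FluidPDE.JetTimeDerivativeEstimates
import Literature.Analysis.FluidPDE.IntermittentJetSecondDeriv
import HarnessLib

/-!
# The intermittent-jet perturbation: second-order sup bounds of the gradient corrector (for (2.3))

Analysis/FluidPDE support file (everything proved): the crude sup bounds of `∂ₖ∂ᵢζ` and of
`∂ᵢ∂ₜζ` for the gradient part `∇ζ` (`ζ = Δ⁻¹G`) of the temporal corrector of
`JetPerturbation`, needed only for the `C¹` bookkeeping bound (2.3) of Buckmaster–Vicol,
Ann. of Math. 189 (2019). Inputs: the sup bounds of `Jet.Bounds`, the second pipe-profile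
derivative bound `|∂ᵢ∂ₗψ̃| ≤ C_ψ σ²μ³` of `IntermittentJetSecondDeriv`, the Morrey-type bound
`‖∂ᵢ∂ⱼφ‖_∞ ≤ K ∑ₘ‖∂ₘΔφ‖_{L⁵}` and the bound `‖∂ᵢΔ⁻¹g‖_∞ ≤ K₁‖g‖_∞` of
`TorusInvLaplacianGradientLp` (as hypotheses with their constants).

## References

* T. Buckmaster, V. Vicol, Ann. of Math. 189 (2019) = arXiv:1709.10033, §2 (2.3). [`BuckmasterVicol2019Annals`]
* T. Buckmaster, V. Vicol, EMS Surv. Math. Sci. 6 (2019) = arXiv:1901.09023, §7.5.3 (7.37). [`BuckmasterVicol2020`]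
-/

noncomputable section

open MeasureTheory Set Filter Topology Function
open scoped InnerProductSpace ContDiff ENNReal NNReal

namespace Literature.Analysis.FluidPDE

namespace JetStep

open Literature.Analysis.FunctionSpaces FunctionSpaces.Torus Mikado NashGeometric Jet

local notation "𝕋³" => UnitAddTorus (Fin 3)
local notation "E³" => EuclideanSpace ℝ (Fin 3)
local notation "Idx" => Index (Fin 3)

namespace Datum

variable {D : Datum} (h : D.Valid) {A₀ A₁ A₂ H₁ H₂ B Cψ : ℝ} (hA : D.AmpBounds A₀ A₁ A₂ H₁ H₂)
  (hB : ∀ x t, Jet.Bounds B (D.J x) D.s x t) (hB1 : 1 ≤ B)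
  (hCψ : ∀ (x : Idx) (i l : Fin 3) (y : 𝕋³), |Torus.partialDeriv i (Torus.partialDeriv l (Jet.psiJ (D.J x) D.s x)) y| ≤ Cψ * (D.σ : ℝ) ^ 2 * D.μ ^ 3)

/-- The sup sizes of `η²ψ̃²`, `∇(η²ψ̃²)`, `∇²(η²ψ̃²)`, `∇(k·∇)(η²ψ̃²)` (polynomials in the parameters). [folklore] -/
def fastSup (D : Datum) (B : ℝ) : ℝ := B ^ 4 * D.κ * D.μ ^ 2

/-- see `fastSup`. [folklore] -/
def dfastSup (D : Datum) (B : ℝ) : ℝ := B ^ 4 * (6 * D.σ * D.κ ^ 2 * D.μ ^ 2 + 2 * D.σ * D.κ * D.μ ^ 3)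

/-- see `fastSup`. [folklore] -/
def ddirSup (D : Datum) (B : ℝ) : ℝ :=
  10 * D.σ * (3 * D.σ * (2 * B ^ 2 * D.κ ^ 3) * (B * D.μ) ^ 2 + 2 * (B ^ 2 * D.κ ^ 2) * (B * D.μ) * (B * D.σ * D.μ ^ 2))

/-- see `fastSup`. [folklore] -/
def ddfastSup (D : Datum) (B Cψ : ℝ) : ℝ :=
  6 * D.σ * (3 * D.σ * (2 * B ^ 2 * D.κ ^ 3) * (B * D.μ) ^ 2 + 2 * (B ^ 2 * D.κ ^ 2) * (B * D.μ) * (B * D.σ * D.μ ^ 2)) +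
    2 * (6 * D.σ * (B ^ 2 * D.κ ^ 2) * (B * D.μ) * (B * D.σ * D.μ ^ 2) +
      (B ^ 2 * D.κ) * ((B * D.σ * D.μ ^ 2) ^ 2 + (B * D.μ) * (Cψ * (D.σ : ℝ) ^ 2 * D.μ ^ 3)))

/-- see `fastSup`: `|∂ₘ∂ⱼF| ≤ ddFSup`. [folklore] -/
def ddFSup (D : Datum) (A₀ H₁ H₂ B Cψ : ℝ) : ℝ := H₂ * D.fastSup B + 2 * H₁ * D.dfastSup B + A₀ ^ 2 * D.ddfastSup B Cψ

/-- see `fastSup`: `|∂ⱼḞ| ≤ dFdotSup`. [folklore] -/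
def dFdotSup (D : Datum) (A₀ H₁ H₂ B : ℝ) : ℝ :=
  H₂ * D.fastSup B + H₁ * D.dfastSup B + H₁ * (D.mup * (10 * D.σ * ((B ^ 2 * D.κ ^ 2) * (B * D.μ) ^ 2))) + A₀ ^ 2 * (D.mup * D.ddirSup B)

include h hB hB1

/-- The elementary sup bounds of the axial/transverse factors, in the parameters of `D`. [folklore] -/
theorem factor_sups (x : Idx) (t : ℝ) (y : 𝕋³) (l : Fin 3) :
    |Jet.eta (D.J x) x t y| ≤ B * D.κ ^ (1 / 2 : ℝ) ∧ |Jet.etaD (D.J x) x t y| ≤ B * D.κ ^ (3 / 2 : ℝ) ∧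
    |Jet.etaDD (D.J x) x t y| ≤ B * D.κ ^ (5 / 2 : ℝ) ∧ |Jet.psiJ (D.J x) D.s x y| ≤ B * D.μ ∧
    |Torus.partialDeriv l (Jet.psiJ (D.J x) D.s x) y| ≤ B * D.σ * D.μ ^ 2 ∧
    (|Jet.eta (D.J x) x t y| ^ 2 ≤ B ^ 2 * D.κ ∧ |Jet.eta (D.J x) x t y| * |Jet.etaD (D.J x) x t y| ≤ B ^ 2 * D.κ ^ 2 ∧
      |Jet.etaD (D.J x) x t y| ^ 2 + |Jet.eta (D.J x) x t y| * |Jet.etaDD (D.J x) x t y| ≤ 2 * B ^ 2 * D.κ ^ 3) := by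
  obtain ⟨hμ, hκ, hσ, hmup, hμ1, hκ1, -⟩ := pos h
  have hB0 : 0 ≤ B := by linarith
  have hJσ : ((D.J x).σ : ℝ) = D.σ := rfl
  have hJμ : (D.J x).μ = D.μ := rfl
  have hJκ : (D.J x).κ = D.κ := rfl
  have e0 := (hB x t).eta_le y
  have e1 := (hB x t).etaD_le y
  have e2 := (hB x t).etaDD_le y
  have p0 := (hB x t).psiJ_le y
  have p1 := (hB x t).partialDeriv_psiJ_le l y
  simp only [hJσ, hJμ, hJκ] at e0 e1 e2 p0 p1
  have hκ' : (D.κ ^ (1 / 2 : ℝ)) ^ 2 = D.κ := by rw [← Real.rpow_natCast, ← Real.rpow_mul hκ.le]; norm_num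
  have hκ2 : D.κ ^ (1 / 2 : ℝ) * D.κ ^ (3 / 2 : ℝ) = D.κ ^ 2 := by
    rw [← Real.rpow_add hκ, show (1 / 2 : ℝ) + 3 / 2 = 2 by norm_num, Real.rpow_two]
  have hκ3 : D.κ ^ (3 / 2 : ℝ) * D.κ ^ (3 / 2 : ℝ) = D.κ ^ 3 := by
    rw [← Real.rpow_add hκ, show (3 / 2 : ℝ) + 3 / 2 = (3 : ℕ) by norm_num, Real.rpow_natCast]
  have hκ3' : D.κ ^ (1 / 2 : ℝ) * D.κ ^ (5 / 2 : ℝ) = D.κ ^ 3 := by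
    rw [← Real.rpow_add hκ, show (1 / 2 : ℝ) + 5 / 2 = (3 : ℕ) by norm_num, Real.rpow_natCast]
  refine ⟨e0, e1, e2, p0, p1, ?_, ?_, ?_⟩
  · calc |Jet.eta (D.J x) x t y| ^ 2 ≤ (B * D.κ ^ (1 / 2 : ℝ)) ^ 2 := pow_le_pow_left₀ (abs_nonneg _) e0 2
      _ = B ^ 2 * D.κ := by rw [mul_pow, hκ']
  · calc |Jet.eta (D.J x) x t y| * |Jet.etaD (D.J x) x t y| ≤ (B * D.κ ^ (1 / 2 : ℝ)) * (B * D.κ ^ (3 / 2 : ℝ)) :=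
          mul_le_mul e0 e1 (abs_nonneg _) (by positivity)
      _ = B ^ 2 * D.κ ^ 2 := by rw [← hκ2]; ring
  · have a1 : |Jet.etaD (D.J x) x t y| ^ 2 ≤ (B * D.κ ^ (3 / 2 : ℝ)) ^ 2 := pow_le_pow_left₀ (abs_nonneg _) e1 2
    have a2 : |Jet.eta (D.J x) x t y| * |Jet.etaDD (D.J x) x t y| ≤ (B * D.κ ^ (1 / 2 : ℝ)) * (B * D.κ ^ (5 / 2 : ℝ)) :=
      mul_le_mul e0 e2 (abs_nonneg _) (by positivity)
    calc _ ≤ (B * D.κ ^ (3 / 2 : ℝ)) ^ 2 + (B * D.κ ^ (1 / 2 : ℝ)) * (B * D.κ ^ (5 / 2 : ℝ)) := add_le_add a1 a2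
      _ = 2 * B ^ 2 * D.κ ^ 3 := by
          rw [show (B * D.κ ^ (3 / 2 : ℝ)) ^ 2 = B ^ 2 * (D.κ ^ (3 / 2 : ℝ) * D.κ ^ (3 / 2 : ℝ)) by ring, hκ3,
            show (B * D.κ ^ (1 / 2 : ℝ)) * (B * D.κ ^ (5 / 2 : ℝ)) = B ^ 2 * (D.κ ^ (1 / 2 : ℝ) * D.κ ^ (5 / 2 : ℝ)) by ring, hκ3']
          ring

omit hB hB1 in
/-- `|∂ₘ(ηη′)| ≤ 3σ(η′² + |η||η″|)`, `|∂ₘ(η²)| ≤ 6σ|η||η′|`, `|∂ₘ(ψ̃²)| ≤ 2|ψ̃||∂ₘψ̃|`. [folklore] -/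
theorem abs_partialDeriv_pairs_le (x : Idx) (t : ℝ) (m : Fin 3) (y : 𝕋³) :
    |Torus.partialDeriv m (fun z => Jet.eta (D.J x) x t z * Jet.etaD (D.J x) x t z) y| ≤
      3 * D.σ * (|Jet.etaD (D.J x) x t y| ^ 2 + |Jet.eta (D.J x) x t y| * |Jet.etaDD (D.J x) x t y|) ∧
    |Torus.partialDeriv m (fun z => Jet.eta (D.J x) x t z * Jet.eta (D.J x) x t z) y| ≤
      6 * D.σ * (|Jet.eta (D.J x) x t y| * |Jet.etaD (D.J x) x t y|) ∧
    |Torus.partialDeriv m (fun z => Jet.psiJ (D.J x) D.s x z * Jet.psiJ (D.J x) D.s x z) y| ≤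
      2 * (|Jet.psiJ (D.J x) D.s x y| * |Torus.partialDeriv m (Jet.psiJ (D.J x) D.s x) y|) := by
  have hJ := Jvalid h x
  have hηs := Jet.isSmooth_eta hJ x t
  have hη's := Jet.isSmooth_etaD hJ x t
  have hψs := isSmooth_psiJ h x
  have hσ0 : (0 : ℝ) ≤ D.σ := (pos h).2.2.1.le
  have hk : |((dir x m : ℤ) : ℝ)| ≤ 3 := abs_dir_le x m
  have hdη : |Torus.partialDeriv m (Jet.eta (D.J x) x t) y| ≤ 3 * D.σ * |Jet.etaD (D.J x) x t y| := by
    rw [Jet.partialDeriv_eta hJ, abs_mul, abs_mul, show ((D.J x).σ : ℝ) = D.σ from rfl, abs_of_nonneg hσ0]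
    calc ↑D.σ * |((dir x m : ℤ) : ℝ)| * |Jet.etaD (D.J x) x t y| ≤ ↑D.σ * 3 * |Jet.etaD (D.J x) x t y| := by gcongr
      _ = _ := by ring
  have hdη' : |Torus.partialDeriv m (Jet.etaD (D.J x) x t) y| ≤ 3 * D.σ * |Jet.etaDD (D.J x) x t y| := by
    rw [Jet.partialDeriv_etaD hJ, abs_mul, abs_mul, show ((D.J x).σ : ℝ) = D.σ from rfl, abs_of_nonneg hσ0]
    calc ↑D.σ * |((dir x m : ℤ) : ℝ)| * |Jet.etaDD (D.J x) x t y| ≤ ↑D.σ * 3 * |Jet.etaDD (D.J x) x t y| := by gcongr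
      _ = _ := by ring
  refine ⟨?_, ?_, ?_⟩
  · refine (abs_partialDeriv_mul_le hηs hη's m y).trans ?_
    calc |Torus.partialDeriv m (Jet.eta (D.J x) x t) y| * |Jet.etaD (D.J x) x t y| + |Jet.eta (D.J x) x t y| * |Torus.partialDeriv m (Jet.etaD (D.J x) x t) y|
        ≤ (3 * D.σ * |Jet.etaD (D.J x) x t y|) * |Jet.etaD (D.J x) x t y| + |Jet.eta (D.J x) x t y| * (3 * D.σ * |Jet.etaDD (D.J x) x t y|) :=
          add_le_add (mul_le_mul_of_nonneg_right hdη (abs_nonneg _)) (mul_le_mul_of_nonneg_left hdη' (abs_nonneg _))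
      _ = _ := by ring
  · refine (abs_partialDeriv_mul_le hηs hηs m y).trans ?_
    calc |Torus.partialDeriv m (Jet.eta (D.J x) x t) y| * |Jet.eta (D.J x) x t y| + |Jet.eta (D.J x) x t y| * |Torus.partialDeriv m (Jet.eta (D.J x) x t) y|
        ≤ (3 * D.σ * |Jet.etaD (D.J x) x t y|) * |Jet.eta (D.J x) x t y| + |Jet.eta (D.J x) x t y| * (3 * D.σ * |Jet.etaD (D.J x) x t y|) :=
          add_le_add (mul_le_mul_of_nonneg_right hdη (abs_nonneg _)) (mul_le_mul_of_nonneg_left hdη (abs_nonneg _))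
      _ = _ := by ring
  · refine (abs_partialDeriv_mul_le hψs hψs m y).trans (le_of_eq ?_)
    ring

/-- **`|∂ₘ (k·∇)(η²ψ̃²)| ≤ ddirSup`** (one derivative on `ψ̃` at most). [folklore] -/
theorem abs_partialDeriv_dirD_fastF_le (x : Idx) (t : ℝ) (m : Fin 3) (y : 𝕋³) :
    |Torus.partialDeriv m (fun z => dirD x (Jet.fastF (D.J x) D.s x t) z) y| ≤ D.ddirSup B := by
  obtain ⟨hμ, hκ, hσ, hmup, -⟩ := pos h
  have hB0 : 0 ≤ B := by linarith
  have hJ := Jvalid h x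
  have hηs := Jet.isSmooth_eta hJ x t
  have hη's := Jet.isSmooth_etaD hJ x t
  have hψs := isSmooth_psiJ h x
  obtain ⟨e0, e1, e2, p0, p1, e00, e01, e12⟩ := factor_sups h hB hB1 x t y m
  obtain ⟨q1, -, q3⟩ := abs_partialDeriv_pairs_le h x t m y
  set c : ℝ := (D.σ : ℝ) * dirNormSq x with hc
  have hd0 := (dirNormSq_pos x).le
  have hc5 : |2 * c| ≤ 10 * D.σ := by
    rw [hc, abs_of_nonneg (by positivity)]; nlinarith [dirNormSq_le' x, hσ.le]
  have e : (fun z => dirD x (Jet.fastF (D.J x) D.s x t) z) = fun z => (2 * c) * ((Jet.eta (D.J x) x t z * Jet.etaD (D.J x) x t z) *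
      (Jet.psiJ (D.J x) D.s x z * Jet.psiJ (D.J x) D.s x z)) := by
    funext z; rw [dirD_fastF h x t z, sq]; ring
  have hP : Torus.IsSmooth (fun z => Jet.eta (D.J x) x t z * Jet.etaD (D.J x) x t z) := hηs.mul hη's
  have hQ : Torus.IsSmooth (fun z => Jet.psiJ (D.J x) D.s x z * Jet.psiJ (D.J x) D.s x z) := hψs.mul hψs
  have hPQ : Torus.IsSmooth (fun z => (Jet.eta (D.J x) x t z * Jet.etaD (D.J x) x t z) * (Jet.psiJ (D.J x) D.s x z * Jet.psiJ (D.J x) D.s x z)) := hP.mul hQ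
  rw [e]
  have hd : Torus.partialDeriv m (fun z => (2 * c) * ((Jet.eta (D.J x) x t z * Jet.etaD (D.J x) x t z) *
      (Jet.psiJ (D.J x) D.s x z * Jet.psiJ (D.J x) D.s x z))) y = (2 * c) * Torus.partialDeriv m (fun z =>
      (Jet.eta (D.J x) x t z * Jet.etaD (D.J x) x t z) * (Jet.psiJ (D.J x) D.s x z * Jet.psiJ (D.J x) D.s x z)) y :=
    ((hPQ.hasDerivAt_line_zero m y).const_mul (2 * c)).deriv
  rw [hd, abs_mul]
  have h2 := abs_partialDeriv_mul_le hP hQ m y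
  have hψ2 : |Jet.psiJ (D.J x) D.s x y * Jet.psiJ (D.J x) D.s x y| ≤ (B * D.μ) ^ 2 := by
    rw [abs_mul, sq]; exact mul_le_mul p0 p0 (abs_nonneg _) (by positivity)
  have hηη : |Jet.eta (D.J x) x t y * Jet.etaD (D.J x) x t y| ≤ B ^ 2 * D.κ ^ 2 := by rw [abs_mul]; exact e01
  have hin : |Torus.partialDeriv m (fun z => (Jet.eta (D.J x) x t z * Jet.etaD (D.J x) x t z) * (Jet.psiJ (D.J x) D.s x z * Jet.psiJ (D.J x) D.s x z)) y| ≤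
      3 * D.σ * (2 * B ^ 2 * D.κ ^ 3) * (B * D.μ) ^ 2 + 2 * (B ^ 2 * D.κ ^ 2) * (B * D.μ) * (B * D.σ * D.μ ^ 2) := by
    refine h2.trans (add_le_add ?_ ?_)
    · exact mul_le_mul (q1.trans (mul_le_mul_of_nonneg_left e12 (by positivity))) hψ2 (abs_nonneg _) (by positivity)
    · calc |Jet.eta (D.J x) x t y * Jet.etaD (D.J x) x t y| * |Torus.partialDeriv m (fun z => Jet.psiJ (D.J x) D.s x z * Jet.psiJ (D.J x) D.s x z) y|
          ≤ (B ^ 2 * D.κ ^ 2) * (2 * ((B * D.μ) * (B * D.σ * D.μ ^ 2))) :=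
            mul_le_mul hηη (q3.trans (mul_le_mul_of_nonneg_left (mul_le_mul p0 p1 (abs_nonneg _) (by positivity)) (by norm_num)))
              (abs_nonneg _) (by positivity)
        _ = _ := by ring
  calc |2 * c| * |Torus.partialDeriv m (fun z => (Jet.eta (D.J x) x t z * Jet.etaD (D.J x) x t z) * (Jet.psiJ (D.J x) D.s x z * Jet.psiJ (D.J x) D.s x z)) y|
      ≤ (10 * D.σ) * (3 * D.σ * (2 * B ^ 2 * D.κ ^ 3) * (B * D.μ) ^ 2 + 2 * (B ^ 2 * D.κ ^ 2) * (B * D.μ) * (B * D.σ * D.μ ^ 2)) :=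
        mul_le_mul hc5 hin (abs_nonneg _) (by positivity)
    _ = D.ddirSup B := rfl

include hCψ

/-- **`|∂ₘ∂ⱼ(η²ψ̃²)| ≤ ddfastSup`**. [folklore] -/
theorem abs_partialDeriv_partialDeriv_fastF_le (x : Idx) (t : ℝ) (m j : Fin 3) (y : 𝕋³) :
    |Torus.partialDeriv m (Torus.partialDeriv j (Jet.fastF (D.J x) D.s x t)) y| ≤ D.ddfastSup B Cψ := by
  obtain ⟨hμ, hκ, hσ, hmup, -⟩ := pos h
  have hB0 : 0 ≤ B := by linarith
  have hJ := Jvalid h x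
  have hηs := Jet.isSmooth_eta hJ x t
  have hη's := Jet.isSmooth_etaD hJ x t
  have hψs := isSmooth_psiJ h x
  obtain ⟨e0, e1, e2, p0, p1, e00, e01, e12⟩ := factor_sups h hB hB1 x t y m
  obtain ⟨-, -, -, -, p1j, -⟩ := factor_sups h hB hB1 x t y j
  have p2 := hCψ x m j y
  obtain ⟨q1, q2, q3⟩ := abs_partialDeriv_pairs_le h x t m y
  -- `∂ⱼ fastF` as a function
  set c : ℝ := (D.σ : ℝ) * (dir x j : ℝ) with hc
  have hc3 : |2 * c| ≤ 6 * D.σ := by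
    rw [hc, abs_mul, abs_mul, abs_two, abs_of_nonneg hσ.le]; nlinarith [abs_dir_le x j, hσ.le]
  have e : Torus.partialDeriv j (Jet.fastF (D.J x) D.s x t) = fun z =>
      (2 * c) * ((Jet.eta (D.J x) x t z * Jet.etaD (D.J x) x t z) * (Jet.psiJ (D.J x) D.s x z * Jet.psiJ (D.J x) D.s x z)) +
      2 * ((Jet.eta (D.J x) x t z * Jet.eta (D.J x) x t z) * (Jet.psiJ (D.J x) D.s x z * Torus.partialDeriv j (Jet.psiJ (D.J x) D.s x) z)) := by
    funext z; rw [partialDeriv_fastF h x t j z, sq, sq]; ring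
  have hP : Torus.IsSmooth (fun z => Jet.eta (D.J x) x t z * Jet.etaD (D.J x) x t z) := hηs.mul hη's
  have hQ : Torus.IsSmooth (fun z => Jet.psiJ (D.J x) D.s x z * Jet.psiJ (D.J x) D.s x z) := hψs.mul hψs
  have hR : Torus.IsSmooth (fun z => Jet.eta (D.J x) x t z * Jet.eta (D.J x) x t z) := hηs.mul hηs
  have hS : Torus.IsSmooth (fun z => Jet.psiJ (D.J x) D.s x z * Torus.partialDeriv j (Jet.psiJ (D.J x) D.s x) z) := hψs.mul (hψs.partialDeriv j)
  have hPQ : Torus.IsSmooth (fun z => (Jet.eta (D.J x) x t z * Jet.etaD (D.J x) x t z) * (Jet.psiJ (D.J x) D.s x z * Jet.psiJ (D.J x) D.s x z)) := hP.mul hQ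
  have hRS : Torus.IsSmooth (fun z => (Jet.eta (D.J x) x t z * Jet.eta (D.J x) x t z) * (Jet.psiJ (D.J x) D.s x z * Torus.partialDeriv j (Jet.psiJ (D.J x) D.s x) z)) := hR.mul hS
  rw [e]
  have hd : Torus.partialDeriv m (fun z => (2 * c) * ((Jet.eta (D.J x) x t z * Jet.etaD (D.J x) x t z) * (Jet.psiJ (D.J x) D.s x z * Jet.psiJ (D.J x) D.s x z)) +
      2 * ((Jet.eta (D.J x) x t z * Jet.eta (D.J x) x t z) * (Jet.psiJ (D.J x) D.s x z * Torus.partialDeriv j (Jet.psiJ (D.J x) D.s x) z))) y =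
      (2 * c) * Torus.partialDeriv m (fun z => (Jet.eta (D.J x) x t z * Jet.etaD (D.J x) x t z) * (Jet.psiJ (D.J x) D.s x z * Jet.psiJ (D.J x) D.s x z)) y +
      2 * Torus.partialDeriv m (fun z => (Jet.eta (D.J x) x t z * Jet.eta (D.J x) x t z) * (Jet.psiJ (D.J x) D.s x z * Torus.partialDeriv j (Jet.psiJ (D.J x) D.s x) z)) y :=
    (((hPQ.hasDerivAt_line_zero m y).const_mul (2 * c)).add ((hRS.hasDerivAt_line_zero m y).const_mul 2)).deriv
  rw [hd]
  have hψ2 : |Jet.psiJ (D.J x) D.s x y * Jet.psiJ (D.J x) D.s x y| ≤ (B * D.μ) ^ 2 := by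
    rw [abs_mul, sq]; exact mul_le_mul p0 p0 (abs_nonneg _) (by positivity)
  have hηη : |Jet.eta (D.J x) x t y * Jet.etaD (D.J x) x t y| ≤ B ^ 2 * D.κ ^ 2 := by rw [abs_mul]; exact e01
  have hη2 : |Jet.eta (D.J x) x t y * Jet.eta (D.J x) x t y| ≤ B ^ 2 * D.κ := by rw [abs_mul, ← sq]; exact e00
  have hψdψ : |Jet.psiJ (D.J x) D.s x y * Torus.partialDeriv j (Jet.psiJ (D.J x) D.s x) y| ≤ (B * D.μ) * (B * D.σ * D.μ ^ 2) := by
    rw [abs_mul]; exact mul_le_mul p0 p1j (abs_nonneg _) (by positivity)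
  have t1 : |Torus.partialDeriv m (fun z => (Jet.eta (D.J x) x t z * Jet.etaD (D.J x) x t z) * (Jet.psiJ (D.J x) D.s x z * Jet.psiJ (D.J x) D.s x z)) y| ≤
      3 * D.σ * (2 * B ^ 2 * D.κ ^ 3) * (B * D.μ) ^ 2 + 2 * (B ^ 2 * D.κ ^ 2) * (B * D.μ) * (B * D.σ * D.μ ^ 2) := by
    refine (abs_partialDeriv_mul_le hP hQ m y).trans (add_le_add ?_ ?_)
    · exact mul_le_mul (q1.trans (mul_le_mul_of_nonneg_left e12 (by positivity))) hψ2 (abs_nonneg _) (by positivity)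
    · calc |Jet.eta (D.J x) x t y * Jet.etaD (D.J x) x t y| * |Torus.partialDeriv m (fun z => Jet.psiJ (D.J x) D.s x z * Jet.psiJ (D.J x) D.s x z) y|
          ≤ (B ^ 2 * D.κ ^ 2) * (2 * ((B * D.μ) * (B * D.σ * D.μ ^ 2))) :=
            mul_le_mul hηη (q3.trans (mul_le_mul_of_nonneg_left (mul_le_mul p0 p1 (abs_nonneg _) (by positivity)) (by norm_num)))
              (abs_nonneg _) (by positivity)
        _ = _ := by ring
  have hdS : |Torus.partialDeriv m (fun z => Jet.psiJ (D.J x) D.s x z * Torus.partialDeriv j (Jet.psiJ (D.J x) D.s x) z) y| ≤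
      (B * D.σ * D.μ ^ 2) ^ 2 + (B * D.μ) * (Cψ * (D.σ : ℝ) ^ 2 * D.μ ^ 3) := by
    refine (abs_partialDeriv_mul_le hψs (hψs.partialDeriv j) m y).trans (add_le_add ?_ ?_)
    · rw [sq]; exact mul_le_mul p1 p1j (abs_nonneg _) (by positivity)
    · exact mul_le_mul p0 p2 (abs_nonneg _) (by positivity)
  have t2 : |Torus.partialDeriv m (fun z => (Jet.eta (D.J x) x t z * Jet.eta (D.J x) x t z) * (Jet.psiJ (D.J x) D.s x z * Torus.partialDeriv j (Jet.psiJ (D.J x) D.s x) z)) y| ≤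
      6 * D.σ * (B ^ 2 * D.κ ^ 2) * ((B * D.μ) * (B * D.σ * D.μ ^ 2)) + (B ^ 2 * D.κ) * ((B * D.σ * D.μ ^ 2) ^ 2 + (B * D.μ) * (Cψ * (D.σ : ℝ) ^ 2 * D.μ ^ 3)) := by
    refine (abs_partialDeriv_mul_le hR hS m y).trans (add_le_add ?_ ?_)
    · calc _ ≤ (6 * D.σ * (B ^ 2 * D.κ ^ 2)) * ((B * D.μ) * (B * D.σ * D.μ ^ 2)) :=
            mul_le_mul (q2.trans (mul_le_mul_of_nonneg_left e01 (by positivity))) hψdψ (abs_nonneg _) (by positivity)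
        _ = _ := by ring
    · exact mul_le_mul hη2 hdS (abs_nonneg _) (by positivity)
  have u1 : |(2 * c) * Torus.partialDeriv m (fun z => (Jet.eta (D.J x) x t z * Jet.etaD (D.J x) x t z) * (Jet.psiJ (D.J x) D.s x z * Jet.psiJ (D.J x) D.s x z)) y| ≤
      (6 * D.σ) * (3 * D.σ * (2 * B ^ 2 * D.κ ^ 3) * (B * D.μ) ^ 2 + 2 * (B ^ 2 * D.κ ^ 2) * (B * D.μ) * (B * D.σ * D.μ ^ 2)) := by
    rw [abs_mul]; exact mul_le_mul hc3 t1 (abs_nonneg _) (by positivity)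
  have u2 : |2 * Torus.partialDeriv m (fun z => (Jet.eta (D.J x) x t z * Jet.eta (D.J x) x t z) * (Jet.psiJ (D.J x) D.s x z * Torus.partialDeriv j (Jet.psiJ (D.J x) D.s x) z)) y| ≤
      2 * (6 * D.σ * (B ^ 2 * D.κ ^ 2) * ((B * D.μ) * (B * D.σ * D.μ ^ 2)) + (B ^ 2 * D.κ) * ((B * D.σ * D.μ ^ 2) ^ 2 + (B * D.μ) * (Cψ * (D.σ : ℝ) ^ 2 * D.μ ^ 3))) := by
    rw [abs_mul, abs_two]; exact mul_le_mul_of_nonneg_left t2 (by norm_num)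
  exact (abs_add_le _ _).trans ((add_le_add u1 u2).trans (le_of_eq (by simp only [ddfastSup]; ring)))

include hA

/-- **`|∂ₘ∂ⱼF| ≤ ddFSup`** on `[0,T]`. [folklore] -/
theorem abs_partialDeriv_partialDeriv_F_le (x : Idx) {t : ℝ} (ht : t ∈ Icc 0 D.T) (m j : Fin 3) (y : 𝕋³) :
    |Torus.partialDeriv m (Torus.partialDeriv j (D.F x t)) y| ≤ D.ddFSup A₀ H₁ H₂ B Cψ := by
  obtain ⟨hμ, hκ, hσ, hmup, -⟩ := pos h
  have hA0 := hA.hA₀; have hH1 := hA.hH₁; have hH2 := hA.hH₂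
  have hB0 : 0 ≤ B := by linarith
  have hh := (smooth_hsq h x).isSmooth_slice ht
  have hf := (smooth_fastF h x).isSmooth_slice ht
  have hF : D.F x t = fun z => JAmp.hsq D.γ₀ D.M x t z * Jet.fastF (D.J x) D.s x t z := funext fun z => by rw [F, a_sq h]
  have e1 : Torus.partialDeriv j (D.F x t) = fun z => Torus.partialDeriv j (JAmp.hsq D.γ₀ D.M x t) z * Jet.fastF (D.J x) D.s x t z +
      JAmp.hsq D.γ₀ D.M x t z * Torus.partialDeriv j (Jet.fastF (D.J x) D.s x t) z := by
    funext z; rw [hF, Torus.partialDeriv_mul (hh.isContDiff (by simp)) (hf.isContDiff (by simp))]; ring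
  have s1 : Torus.IsSmooth (fun z => Torus.partialDeriv j (JAmp.hsq D.γ₀ D.M x t) z * Jet.fastF (D.J x) D.s x t z) := (hh.partialDeriv j).mul hf
  have s2 : Torus.IsSmooth (fun z => JAmp.hsq D.γ₀ D.M x t z * Torus.partialDeriv j (Jet.fastF (D.J x) D.s x t) z) := hh.mul (hf.partialDeriv j)
  rw [e1]
  have hd : Torus.partialDeriv m (fun z => Torus.partialDeriv j (JAmp.hsq D.γ₀ D.M x t) z * Jet.fastF (D.J x) D.s x t z +
      JAmp.hsq D.γ₀ D.M x t z * Torus.partialDeriv j (Jet.fastF (D.J x) D.s x t) z) y =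
      Torus.partialDeriv m (fun z => Torus.partialDeriv j (JAmp.hsq D.γ₀ D.M x t) z * Jet.fastF (D.J x) D.s x t z) y +
      Torus.partialDeriv m (fun z => JAmp.hsq D.γ₀ D.M x t z * Torus.partialDeriv j (Jet.fastF (D.J x) D.s x t) z) y :=
    ((s1.hasDerivAt_line_zero m y).add (s2.hasDerivAt_line_zero m y)).deriv
  rw [hd]
  -- sup of fastF and its derivatives
  have hf0 : 0 ≤ Jet.fastF (D.J x) D.s x t y := by unfold Jet.fastF; positivity
  have hfast : |Jet.fastF (D.J x) D.s x t y| ≤ D.fastSup B := by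
    rw [abs_of_nonneg hf0]
    obtain ⟨e0, -, -, p0, -⟩ := factor_sups h hB hB1 x t y m
    have e1' : Jet.fastF (D.J x) D.s x t y = |Jet.eta (D.J x) x t y| ^ 2 * |Jet.psiJ (D.J x) D.s x y| ^ 2 := by rw [Jet.fastF, sq_abs, sq_abs]
    have hκ' : (D.κ ^ (1 / 2 : ℝ)) ^ 2 = D.κ := by rw [← Real.rpow_natCast, ← Real.rpow_mul hκ.le]; norm_num
    rw [e1']
    calc |Jet.eta (D.J x) x t y| ^ 2 * |Jet.psiJ (D.J x) D.s x y| ^ 2 ≤ (B * D.κ ^ (1 / 2 : ℝ)) ^ 2 * (B * D.μ) ^ 2 :=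
          mul_le_mul (pow_le_pow_left₀ (abs_nonneg _) e0 2) (pow_le_pow_left₀ (abs_nonneg _) p0 2) (by positivity) (by positivity)
      _ = D.fastSup B := by rw [mul_pow, hκ', fastSup]; ring
  have hdfast : ∀ l, |Torus.partialDeriv l (Jet.fastF (D.J x) D.s x t) y| ≤ D.dfastSup B := by
    intro l
    obtain ⟨e0, e1, -, p0, p1, e00, e01, -⟩ := factor_sups h hB hB1 x t y l
    rw [partialDeriv_fastF h x t l y]
    refine (abs_add_le _ _).trans ?_
    have hk := abs_dir_le x l
    have a1 : |2 * ((D.σ : ℝ) * (dir x l : ℝ)) * (Jet.eta (D.J x) x t y * Jet.etaD (D.J x) x t y) * Jet.psiJ (D.J x) D.s x y ^ 2| ≤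
        6 * D.σ * (B ^ 2 * D.κ ^ 2) * (B * D.μ) ^ 2 := by
      rw [abs_mul, abs_mul, abs_mul, abs_mul, abs_two, abs_of_nonneg hσ.le, abs_of_nonneg (sq_nonneg (Jet.psiJ (D.J x) D.s x y)), abs_mul, ← sq_abs (Jet.psiJ _ _ _ _)]
      calc 2 * (↑D.σ * |((dir x l : ℤ) : ℝ)|) * (|Jet.eta (D.J x) x t y| * |Jet.etaD (D.J x) x t y|) * |Jet.psiJ (D.J x) D.s x y| ^ 2
          ≤ 2 * (↑D.σ * 3) * (B ^ 2 * D.κ ^ 2) * (B * D.μ) ^ 2 := by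
            refine mul_le_mul (mul_le_mul (by gcongr) e01 (by positivity) (by positivity)) (pow_le_pow_left₀ (abs_nonneg _) p0 2)
              (by positivity) (by positivity)
        _ = _ := by ring
    have a2 : |2 * Jet.eta (D.J x) x t y ^ 2 * (Jet.psiJ (D.J x) D.s x y * Torus.partialDeriv l (Jet.psiJ (D.J x) D.s x) y)| ≤
        2 * (B ^ 2 * D.κ) * ((B * D.μ) * (B * D.σ * D.μ ^ 2)) := by
      rw [abs_mul, abs_mul, abs_two, ← sq_abs (Jet.eta _ _ _ _), abs_of_nonneg (sq_nonneg _), abs_mul]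
      exact mul_le_mul (mul_le_mul_of_nonneg_left e00 (by norm_num)) (mul_le_mul p0 p1 (abs_nonneg _) (by positivity))
        (by positivity) (by positivity)
    refine (add_le_add a1 a2).trans (le_of_eq ?_)
    simp only [dfastSup]; ring
  have hddfast := abs_partialDeriv_partialDeriv_fastF_le h hB hB1 hCψ x t m j y
  have hfS0 : 0 ≤ D.fastSup B := (abs_nonneg _).trans hfast
  have hdfS0 : 0 ≤ D.dfastSup B := (abs_nonneg _).trans (hdfast m)
  have b1 : |Torus.partialDeriv m (fun z => Torus.partialDeriv j (JAmp.hsq D.γ₀ D.M x t) z * Jet.fastF (D.J x) D.s x t z) y| ≤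
      H₂ * D.fastSup B + H₁ * D.dfastSup B := by
    refine (abs_partialDeriv_mul_le (hh.partialDeriv j) hf m y).trans (add_le_add ?_ ?_)
    · exact mul_le_mul (hA.ddh_le x t ht y j m) hfast (abs_nonneg _) hH2
    · exact mul_le_mul (hA.dh_le x t ht y j) (hdfast m) (abs_nonneg _) hH1
  have b2 : |Torus.partialDeriv m (fun z => JAmp.hsq D.γ₀ D.M x t z * Torus.partialDeriv j (Jet.fastF (D.J x) D.s x t) z) y| ≤
      H₁ * D.dfastSup B + A₀ ^ 2 * D.ddfastSup B Cψ := by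
    refine (abs_partialDeriv_mul_le hh (hf.partialDeriv j) m y).trans (add_le_add ?_ ?_)
    · exact mul_le_mul (hA.dh_le x t ht y m) (hdfast j) (abs_nonneg _) hH1
    · have hhs := hsq_le h hA x ht y
      rw [abs_of_nonneg hhs.1]
      exact mul_le_mul hhs.2 hddfast (abs_nonneg _) (by positivity)
  refine (abs_add_le _ _).trans ((add_le_add b1 b2).trans (le_of_eq ?_))
  simp only [ddFSup]; ring

/-- **Sup bound of `∂ₖ∂ᵢζ`** (Morrey bound applied to `φ = Δ⁻¹G`, `ΔΔ⁻¹G = G - ∫G`,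
`∂ₘG = ∑_x μ′⁻¹ ∑ⱼ kⱼ ∂ₘ∂ⱼF_x`). [cite: BuckmasterVicol2019Annals, §2 (2.3)] -/
theorem abs_partialDeriv_partialDeriv_zeta_le_sup {K : ℝ≥0}
    (hK : ∀ φ : 𝕋³ → ℝ, Torus.IsSmooth φ → ∀ (i j : Fin 3) (y : 𝕋³), ‖Torus.partialDeriv i (Torus.partialDeriv j φ) y‖ₑ ≤
      K * ∑ m, eLpNorm (Torus.partialDeriv m (Torus.laplacian φ)) (ENNReal.ofReal ((Fintype.card (Fin 3) : ℝ) + 2)) volume)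
    {t : ℝ} (ht : t ∈ Icc 0 D.T) (k i : Fin 3) (y : 𝕋³) :
    |Torus.partialDeriv k (Torus.partialDeriv i (D.zeta t)) y| ≤ (K : ℝ) * (3 * (NN * (9 * D.mup⁻¹ * D.ddFSup A₀ H₁ H₂ B Cψ))) := by
  obtain ⟨hμ, hκ, hσ, hmup, -⟩ := pos h
  have hG : Torus.IsSmooth (D.G t) := (smooth_G h).isSmooth_slice ht
  -- sup of `∂ₘ G`
  have hdd := fun x m j z => abs_partialDeriv_partialDeriv_F_le h hA hB hB1 hCψ x ht m j z
  have hQ0 : 0 ≤ D.ddFSup A₀ H₁ H₂ B Cψ := (abs_nonneg _).trans (hdd (Classical.arbitrary Idx) k i y)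
  have hdG : ∀ m z, |Torus.partialDeriv m (D.G t) z| ≤ NN * (9 * D.mup⁻¹ * D.ddFSup A₀ H₁ H₂ B Cψ) := by
    intro m z
    have hl : ∀ x l, Torus.IsSmooth (fun y => ((dir x l : ℤ) : ℝ) * Torus.partialDeriv l (D.F x t) y) := fun x l =>
      (Torus.isSmooth_const _).mul ((isSmooth_F h x ht).partialDeriv l)
    have hin' : ∀ x, Torus.IsSmooth (fun y => dirD x (D.F x t) y) := fun x => by
      unfold dirD; exact Torus.isSmooth_finset_sum _ fun l _ => hl x l
    have hterm : ∀ x, Torus.IsSmooth (fun y => D.mup⁻¹ * dirD x (D.F x t) y) := fun x => (Torus.isSmooth_const _).mul (hin' x)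
    rw [show D.G t = fun y => ∑ x ∈ Finset.univ, D.mup⁻¹ * dirD x (D.F x t) y from rfl,
      Torus.partialDeriv_finset_sum Finset.univ fun x _ => (hterm x).isContDiff (by simp)]
    refine (Finset.abs_sum_le_sum_abs _ _).trans (sum_le_NN_mul fun x => ?_)
    have hin : Torus.IsSmooth (fun y => dirD x (D.F x t) y) := hin' x
    have hd1 : Torus.partialDeriv m (fun y => D.mup⁻¹ * dirD x (D.F x t) y) z = D.mup⁻¹ * Torus.partialDeriv m (fun y => dirD x (D.F x t) y) z :=
      ((hin.hasDerivAt_line_zero m z).const_mul D.mup⁻¹).deriv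
    have hd2 := abs_partialDeriv_sum_mul_le (fun j => Torus.isSmooth_const ((dir x j : ℤ) : ℝ)) (fun j => (isSmooth_F h x ht).partialDeriv j) m z
    rw [hd1, abs_mul, abs_of_pos (inv_pos.2 hmup)]
    have h9 : |Torus.partialDeriv m (fun y => dirD x (D.F x t) y) z| ≤ 9 * D.ddFSup A₀ H₁ H₂ B Cψ := by
      refine (le_of_eq (by rfl)).trans (hd2.trans ?_)
      calc ∑ j, (|Torus.partialDeriv m (fun _ : 𝕋³ => ((dir x j : ℤ) : ℝ)) z| * |Torus.partialDeriv j (D.F x t) z| +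
            |((dir x j : ℤ) : ℝ)| * |Torus.partialDeriv m (Torus.partialDeriv j (D.F x t)) z|)
          ≤ ∑ _j : Fin 3, (0 + 3 * D.ddFSup A₀ H₁ H₂ B Cψ) := Finset.sum_le_sum fun j _ => by
            rw [Torus.partialDeriv_const_apply, abs_zero, zero_mul]
            exact add_le_add le_rfl (mul_le_mul (abs_dir_le x j) (hdd x m j z) (abs_nonneg _) (by norm_num))
        _ = 9 * D.ddFSup A₀ H₁ H₂ B Cψ := by simp only [Finset.sum_const, Finset.card_univ, Fintype.card_fin, nsmul_eq_mul, Nat.cast_ofNat]; ring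
    calc D.mup⁻¹ * |Torus.partialDeriv m (fun y => dirD x (D.F x t) y) z| ≤ D.mup⁻¹ * (9 * D.ddFSup A₀ H₁ H₂ B Cψ) :=
          mul_le_mul_of_nonneg_left h9 (by positivity)
      _ = _ := by ring
  -- Morrey
  set Q := NN * (9 * D.mup⁻¹ * D.ddFSup A₀ H₁ H₂ B Cψ) with hQ
  have hQ0' : 0 ≤ Q := (abs_nonneg _).trans (hdG k y)
  have hφ : Torus.IsSmooth (Torus.invLaplacian (D.G t)) := Torus.isSmooth_invLaplacian hG
  have h1 := hK _ hφ k i y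
  have eL : Torus.laplacian (Torus.invLaplacian (D.G t)) = fun z => D.G t z - ∫ z', D.G t z' := funext (Torus.laplacian_invLaplacian hG)
  have hdm : ∀ m, Torus.partialDeriv m (Torus.laplacian (Torus.invLaplacian (D.G t))) = Torus.partialDeriv m (D.G t) := by
    intro m; rw [eL]; funext z; exact ((hG.hasDerivAt_line_zero m z).sub_const _).deriv
  have hLp : ∀ m, eLpNorm (Torus.partialDeriv m (Torus.laplacian (Torus.invLaplacian (D.G t)))) (ENNReal.ofReal ((Fintype.card (Fin 3) : ℝ) + 2)) volume ≤
      ENNReal.ofReal Q := fun m => by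
    rw [hdm m]
    exact Torus.eLpNorm_le_of_forall_norm_le (fun z => by rw [Real.norm_eq_abs]; exact hdG m z) _
  have h2 : ‖Torus.partialDeriv k (Torus.partialDeriv i (Torus.invLaplacian (D.G t))) y‖ₑ ≤ ENNReal.ofReal ((K : ℝ) * (3 * Q)) := by
    refine h1.trans ?_
    calc (K : ℝ≥0∞) * ∑ m, eLpNorm (Torus.partialDeriv m (Torus.laplacian (Torus.invLaplacian (D.G t)))) (ENNReal.ofReal ((Fintype.card (Fin 3) : ℝ) + 2)) volume
        ≤ (K : ℝ≥0∞) * ∑ _m : Fin 3, ENNReal.ofReal Q := mul_le_mul_right (Finset.sum_le_sum fun m _ => hLp m) _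
      _ = ENNReal.ofReal ((K : ℝ) * (3 * Q)) := by
          rw [Finset.sum_const, Finset.card_univ, Fintype.card_fin, nsmul_eq_mul, Nat.cast_ofNat, ← ENNReal.ofReal_ofNat 3,
            ← ENNReal.ofReal_mul (by norm_num), ENNReal.ofReal_mul K.coe_nonneg, ENNReal.ofReal_coe_nnreal]
  have hKQ : 0 ≤ (K : ℝ) * (3 * Q) := by positivity
  rw [← ofReal_norm, ENNReal.ofReal_le_ofReal_iff hKQ, Real.norm_eq_abs] at h2
  exact h2

/-! ## `∂ᵢ∂ₜζ` -/

omit hCψ in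
/-- **`|∂ⱼḞ| ≤ dFdotSup`** on `[0,T]`. [folklore] -/
theorem abs_partialDeriv_Fdot_le (x : Idx) {t : ℝ} (ht : t ∈ Icc 0 D.T) (j : Fin 3) (y : 𝕋³) :
    |Torus.partialDeriv j (D.Fdot x t) y| ≤ D.dFdotSup A₀ H₁ H₂ B := by
  obtain ⟨hμ, hκ, hσ, hmup, -⟩ := pos h
  have hA0 := hA.hA₀; have hH1 := hA.hH₁; have hH2 := hA.hH₂
  have hB0 : 0 ≤ B := by linarith
  have hT := h.hT
  have hh := (smooth_hsq h x).isSmooth_slice ht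
  have hf := (smooth_fastF h x).isSmooth_slice ht
  have hhd : Torus.IsSmooth (D.hdot x t) := (smooth_hdot h x).isSmooth_slice ht
  have hl : ∀ l, Torus.IsSmooth (fun z => ((dir x l : ℤ) : ℝ) * Torus.partialDeriv l (Jet.fastF (D.J x) D.s x t) z) := fun l =>
    (Torus.isSmooth_const _).mul (hf.partialDeriv l)
  have hD : Torus.IsSmooth (fun z => dirD x (Jet.fastF (D.J x) D.s x t) z) := by
    unfold dirD; exact Torus.isSmooth_finset_sum _ fun l _ => hl l
  -- `Ḟ` as a function of space
  have e : D.Fdot x t = fun z => D.hdot x t z * Jet.fastF (D.J x) D.s x t z + JAmp.hsq D.γ₀ D.M x t z * (D.mup * dirD x (Jet.fastF (D.J x) D.s x t) z) :=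
    funext fun z => Fdot_eq h x ht z
  have s1 : Torus.IsSmooth (fun z => D.hdot x t z * Jet.fastF (D.J x) D.s x t z) := hhd.mul hf
  have s2' : Torus.IsSmooth (fun z => D.mup * dirD x (Jet.fastF (D.J x) D.s x t) z) := (Torus.isSmooth_const _).mul hD
  have s2 : Torus.IsSmooth (fun z => JAmp.hsq D.γ₀ D.M x t z * (D.mup * dirD x (Jet.fastF (D.J x) D.s x t) z)) := hh.mul s2'
  rw [e]
  have hd : Torus.partialDeriv j (fun z => D.hdot x t z * Jet.fastF (D.J x) D.s x t z + JAmp.hsq D.γ₀ D.M x t z * (D.mup * dirD x (Jet.fastF (D.J x) D.s x t) z)) y =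
      Torus.partialDeriv j (fun z => D.hdot x t z * Jet.fastF (D.J x) D.s x t z) y +
      Torus.partialDeriv j (fun z => JAmp.hsq D.γ₀ D.M x t z * (D.mup * dirD x (Jet.fastF (D.J x) D.s x t) z)) y :=
    ((s1.hasDerivAt_line_zero j y).add (s2.hasDerivAt_line_zero j y)).deriv
  rw [hd]
  -- `|∂ⱼḣ| ≤ H₂` by commuting the derivatives
  have hdhd : |Torus.partialDeriv j (D.hdot x t) y| ≤ H₂ := by
    have := Torus.timeDerivWithin_partialDeriv_comm hT (smooth_hsq h x) ht j y
    rw [show D.hdot x t = Torus.timeDerivWithin (Icc 0 D.T) (JAmp.hsq D.γ₀ D.M x) t from rfl, ← this]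
    exact hA.dtdh_le x t ht y j
  -- sup pieces
  have hf0 : 0 ≤ Jet.fastF (D.J x) D.s x t y := by unfold Jet.fastF; positivity
  obtain ⟨e0, e1', -, p0, p1, e00, e01, -⟩ := factor_sups h hB hB1 x t y j
  have hfast : |Jet.fastF (D.J x) D.s x t y| ≤ D.fastSup B := by
    rw [abs_of_nonneg hf0]
    have e1'' : Jet.fastF (D.J x) D.s x t y = |Jet.eta (D.J x) x t y| ^ 2 * |Jet.psiJ (D.J x) D.s x y| ^ 2 := by rw [Jet.fastF, sq_abs, sq_abs]
    have hκ' : (D.κ ^ (1 / 2 : ℝ)) ^ 2 = D.κ := by rw [← Real.rpow_natCast, ← Real.rpow_mul hκ.le]; norm_num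
    rw [e1'']
    calc |Jet.eta (D.J x) x t y| ^ 2 * |Jet.psiJ (D.J x) D.s x y| ^ 2 ≤ (B * D.κ ^ (1 / 2 : ℝ)) ^ 2 * (B * D.μ) ^ 2 :=
          mul_le_mul (pow_le_pow_left₀ (abs_nonneg _) e0 2) (pow_le_pow_left₀ (abs_nonneg _) p0 2) (by positivity) (by positivity)
      _ = D.fastSup B := by rw [mul_pow, hκ', fastSup]; ring
  have hdfast : |Torus.partialDeriv j (Jet.fastF (D.J x) D.s x t) y| ≤ D.dfastSup B := by
    rw [partialDeriv_fastF h x t j y]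
    refine (abs_add_le _ _).trans ?_
    have hk := abs_dir_le x j
    have a1 : |2 * ((D.σ : ℝ) * (dir x j : ℝ)) * (Jet.eta (D.J x) x t y * Jet.etaD (D.J x) x t y) * Jet.psiJ (D.J x) D.s x y ^ 2| ≤
        6 * D.σ * (B ^ 2 * D.κ ^ 2) * (B * D.μ) ^ 2 := by
      rw [abs_mul, abs_mul, abs_mul, abs_mul, abs_two, abs_of_nonneg hσ.le, abs_of_nonneg (sq_nonneg (Jet.psiJ (D.J x) D.s x y)), abs_mul, ← sq_abs (Jet.psiJ _ _ _ _)]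
      calc 2 * (↑D.σ * |((dir x j : ℤ) : ℝ)|) * (|Jet.eta (D.J x) x t y| * |Jet.etaD (D.J x) x t y|) * |Jet.psiJ (D.J x) D.s x y| ^ 2
          ≤ 2 * (↑D.σ * 3) * (B ^ 2 * D.κ ^ 2) * (B * D.μ) ^ 2 := by
            refine mul_le_mul (mul_le_mul (by gcongr) e01 (by positivity) (by positivity)) (pow_le_pow_left₀ (abs_nonneg _) p0 2)
              (by positivity) (by positivity)
        _ = _ := by ring
    have a2 : |2 * Jet.eta (D.J x) x t y ^ 2 * (Jet.psiJ (D.J x) D.s x y * Torus.partialDeriv j (Jet.psiJ (D.J x) D.s x) y)| ≤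
        2 * (B ^ 2 * D.κ) * ((B * D.μ) * (B * D.σ * D.μ ^ 2)) := by
      rw [abs_mul, abs_mul, abs_two, ← sq_abs (Jet.eta _ _ _ _), abs_of_nonneg (sq_nonneg _), abs_mul]
      exact mul_le_mul (mul_le_mul_of_nonneg_left e00 (by norm_num)) (mul_le_mul p0 p1 (abs_nonneg _) (by positivity))
        (by positivity) (by positivity)
    refine (add_le_add a1 a2).trans (le_of_eq ?_)
    simp only [dfastSup]; ring
  have hdir : |dirD x (Jet.fastF (D.J x) D.s x t) y| ≤ 10 * D.σ * ((B ^ 2 * D.κ ^ 2) * (B * D.μ) ^ 2) := by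
    have hd5 := dirNormSq_le' x
    have hd0 := (dirNormSq_pos x).le
    rw [dirD_fastF h x t y, abs_mul, abs_mul, abs_mul, abs_two, abs_of_nonneg (mul_nonneg hσ.le hd0),
      abs_of_nonneg (sq_nonneg (Jet.psiJ (D.J x) D.s x y)), abs_mul, ← sq_abs (Jet.psiJ _ _ _ _)]
    calc 2 * (↑D.σ * dirNormSq x) * (|Jet.eta (D.J x) x t y| * |Jet.etaD (D.J x) x t y|) * |Jet.psiJ (D.J x) D.s x y| ^ 2
        ≤ 2 * (↑D.σ * 5) * (B ^ 2 * D.κ ^ 2) * (B * D.μ) ^ 2 := by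
          refine mul_le_mul (mul_le_mul (by gcongr) e01 (by positivity) (by positivity)) (pow_le_pow_left₀ (abs_nonneg _) p0 2)
            (by positivity) (by positivity)
      _ = _ := by ring
  have hddir := abs_partialDeriv_dirD_fastF_le h hB hB1 x t j y
  have b1 : |Torus.partialDeriv j (fun z => D.hdot x t z * Jet.fastF (D.J x) D.s x t z) y| ≤ H₂ * D.fastSup B + H₁ * D.dfastSup B := by
    refine (abs_partialDeriv_mul_le hhd hf j y).trans (add_le_add ?_ ?_)
    · exact mul_le_mul hdhd hfast (abs_nonneg _) hH2
    · exact mul_le_mul (hA.dth_le x t ht y) hdfast (abs_nonneg _) hH1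
  have b2 : |Torus.partialDeriv j (fun z => JAmp.hsq D.γ₀ D.M x t z * (D.mup * dirD x (Jet.fastF (D.J x) D.s x t) z)) y| ≤
      H₁ * (D.mup * (10 * D.σ * ((B ^ 2 * D.κ ^ 2) * (B * D.μ) ^ 2))) + A₀ ^ 2 * (D.mup * D.ddirSup B) := by
    refine (abs_partialDeriv_mul_le hh s2' j y).trans (add_le_add ?_ ?_)
    · rw [abs_mul, abs_of_pos hmup]
      exact mul_le_mul (hA.dh_le x t ht y j) (mul_le_mul_of_nonneg_left hdir hmup.le) (by positivity) hH1
    · have hhs := hsq_le h hA x ht y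
      rw [abs_of_nonneg hhs.1]
      have hd' : Torus.partialDeriv j (fun z => D.mup * dirD x (Jet.fastF (D.J x) D.s x t) z) y = D.mup * Torus.partialDeriv j (fun z => dirD x (Jet.fastF (D.J x) D.s x t) z) y :=
        ((hD.hasDerivAt_line_zero j y).const_mul D.mup).deriv
      rw [hd', abs_mul, abs_of_pos hmup]
      exact mul_le_mul hhs.2 (mul_le_mul_of_nonneg_left hddir hmup.le) (by positivity) (by positivity)
  refine (abs_add_le _ _).trans ((add_le_add b1 b2).trans (le_of_eq ?_))
  simp only [dFdotSup]
  ring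

omit hCψ in
/-- **`∂ₜG = ∑_x μ′⁻¹ ∑ⱼ kⱼ ∂ⱼḞ_x`** and its sup bound `|∂ₜG| ≤ 9Nμ′⁻¹ dFdotSup`. [folklore] -/
theorem abs_timeDerivWithin_G_le {t : ℝ} (ht : t ∈ Icc 0 D.T) (y : 𝕋³) :
    |Torus.timeDerivWithin (Icc 0 D.T) D.G t y| ≤ NN * (9 * D.mup⁻¹ * D.dFdotSup A₀ H₁ H₂ B) := by
  obtain ⟨hμ, hκ, hσ, hmup, -⟩ := pos h
  have hT := h.hT
  have hU := uniqueDiffOn h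
  have key : HasDerivWithinAt (fun s => D.G s y) (∑ x, D.mup⁻¹ * ∑ j, ((dir x j : ℤ) : ℝ) * Torus.partialDeriv j (D.Fdot x t) y) (Icc 0 D.T) t := by
    unfold Datum.G dirD
    refine HasDerivWithinAt.fun_sum fun x _ => (HasDerivWithinAt.fun_sum fun j _ => ?_).const_mul _
    have h1 := ((smooth_F h x).partialDeriv hU j).hasDerivWithinAt_slice ht y
    have hc := Torus.timeDerivWithin_partialDeriv_comm hT (smooth_F h x) ht j y
    exact (h1.congr_deriv (by rw [hc]; rfl)).const_mul _
  rw [show Torus.timeDerivWithin (Icc 0 D.T) D.G t y = derivWithin (fun s => D.G s y) (Icc 0 D.T) t from rfl, key.derivWithin (hU t ht)]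
  refine (Finset.abs_sum_le_sum_abs _ _).trans (sum_le_NN_mul fun x => ?_)
  rw [abs_mul, abs_of_pos (inv_pos.2 hmup)]
  have hQ := fun j => abs_partialDeriv_Fdot_le h hA hB hB1 x ht j y
  calc D.mup⁻¹ * |∑ j, ((dir x j : ℤ) : ℝ) * Torus.partialDeriv j (D.Fdot x t) y| ≤ D.mup⁻¹ * ∑ _j : Fin 3, 3 * D.dFdotSup A₀ H₁ H₂ B := by
        refine mul_le_mul_of_nonneg_left ((Finset.abs_sum_le_sum_abs _ _).trans (Finset.sum_le_sum fun j _ => ?_)) (by positivity)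
        rw [abs_mul]; exact mul_le_mul (abs_dir_le x j) (hQ j) (abs_nonneg _) (by norm_num)
    _ = 9 * D.mup⁻¹ * D.dFdotSup A₀ H₁ H₂ B := by
        simp only [Finset.sum_const, Finset.card_univ, Fintype.card_fin, nsmul_eq_mul, Nat.cast_ofNat]; ring

omit hCψ in
/-- **Sup bound of `∂ᵢ∂ₜζ = ∂ᵢΔ⁻¹(∂ₜG)`**. [cite: BuckmasterVicol2019Annals, §2 (2.3)] -/
theorem abs_partialDeriv_zetadot_le_sup {K₁ : ℝ≥0}
    (hK₁ : ∀ g : 𝕋³ → ℝ, Torus.IsSmooth g → ∀ (i : Fin 3) (y : 𝕋³), ‖Torus.partialDeriv i (Torus.invLaplacian g) y‖ₑ ≤ K₁ * eLpNorm g ⊤ volume)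
    {t : ℝ} (ht : t ∈ Icc 0 D.T) (i : Fin 3) (y : 𝕋³) :
    |Torus.partialDeriv i (D.zetadot t) y| ≤ (K₁ : ℝ) * (NN * (9 * D.mup⁻¹ * D.dFdotSup A₀ H₁ H₂ B)) := by
  have hT := h.hT
  have hU := uniqueDiffOn h
  have hGt : Torus.IsSmooth (Torus.timeDerivWithin (Icc 0 D.T) D.G t) := (smooth_G h).isSmooth_timeDerivWithin hU ht
  have e : D.zetadot t = Torus.invLaplacian (Torus.timeDerivWithin (Icc 0 D.T) D.G t) := by
    funext z
    show Torus.timeDerivWithin (Icc 0 D.T) D.zeta t z = _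
    rw [show D.zeta = fun s => Torus.invLaplacian (D.G s) from rfl]
    exact Torus.timeDerivWithin_invLaplacian hT (smooth_G h) ht z
  set Q := NN * (9 * D.mup⁻¹ * D.dFdotSup A₀ H₁ H₂ B) with hQ
  have hQ0 : 0 ≤ Q := (abs_nonneg _).trans (abs_timeDerivWithin_G_le h hA hB hB1 ht y)
  have h1 := hK₁ _ hGt i y
  have h2 : eLpNorm (Torus.timeDerivWithin (Icc 0 D.T) D.G t) ⊤ volume ≤ ENNReal.ofReal Q :=
    Torus.eLpNorm_le_of_forall_norm_le (fun z => by rw [Real.norm_eq_abs]; exact abs_timeDerivWithin_G_le h hA hB hB1 ht z) _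
  rw [e]
  have h3 : ‖Torus.partialDeriv i (Torus.invLaplacian (Torus.timeDerivWithin (Icc 0 D.T) D.G t)) y‖ₑ ≤ ENNReal.ofReal ((K₁ : ℝ) * Q) := by
    refine h1.trans ?_
    rw [ENNReal.ofReal_mul K₁.coe_nonneg, ENNReal.ofReal_coe_nnreal]
    exact mul_le_mul_right h2 _
  have hKQ : 0 ≤ (K₁ : ℝ) * Q := by positivity
  rw [← ofReal_norm, ENNReal.ofReal_le_ofReal_iff hKQ, Real.norm_eq_abs] at h3
  exact h3

end Datum

end JetStep

end Literature.Analysis.FluidPDE
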